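import Summits.HubbardSuperconductivity.HubbardSuperconductivity.Theorems.AnisotropyChordTransferFibre3WindowRate
import Summits.HubbardSuperconductivity.HubbardSuperconductivity.Theorems.AnisotropyChordTransferFibre3LamPart
import Summits.HubbardSuperconductivity.HubbardSuperconductivity.Theorems.AnisotropyChordTransferFibre3ShellMajorant

/-!
# Route `AnisotropyChord` / H0 rotor rung: the LARGE-`L` CHANNEL INEQUALITIES of the bond Birman–Schwinger criterion for HOLE₂(.75)

The bond Birman–Schwinger + Weyl criterion of prover seat `hubbard-h0-rotor-p3` g4 (cell STATUS 2026-08-30T00:55Z) reduces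
HOLE₂(g) = `TwoHoleGap L g` (Neumann gap `≥ g` of the twice-punctured torus, every pair of deleted vertices) to TWO values of the
torus potential kernel `a_L(r; 2g) = aKer L (2g) r` at the points `(2,0)` and `(1,1)`: the one-hole `p`-channel value
`μ_p = a_L((2,0); 2g) ≤ 1/2` and the `d`-channel value `μ_d = 2a_L((1,1); 2g) − a_L((2,0); 2g) ≤ 1/2` (the log-divergent capacity
sits in the `s`-channel only and never enters).  This file supplies these two inequalities ANALYTICALLY at `2g = (3/2)ε₁`
(HOLE₂(.75)) for EVERY `L ≥ 39`, from tree theorems only: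

* `Subsample.dev_two_zero`, `Subsample.dev_one_one` (p1 g25, …WindowRate): `|a_L(r;0) − a_∞(r)| ≤ 4/L², 1/L²` at `r = (2,0), (1,1)`, `L ≥ 12`;
* `Subsample.aZ2_two_zero'`, `Subsample.aZ2_one_one` (p1 g25, …DiagonalValues): `a_∞(2,0) = 1 − 2/π`, `a_∞(1,1) = 1/π`;
* `RateLemma.lamPartShellBound_holds` + `RateLemma.shellMajorant_holds` (p2 g0/g2, …LamPart, …ShellMajorant): the λ-part
  `0 ≤ a_L(r;λ) − a_L(r;0) ≤ |r|²(11.71 ln L + 5.9)/L²` for `0 ≤ λ ≤ (3/2)ε₁`, `L ≥ 8`;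
* `Real.pi_gt_3141592`, `Real.add_one_le_exp` (`ln 39 ≤ 3.75` via `(1 + 1/32)^120 ≥ 39`) and concavity `ln L ≤ ln 39 + L/39 − 1`.

Results (namespace `…Fibre3.ChannelLarge`): the explicit window bounds `aKer_two_zero_le` / `aKer_two_zero_ge` / `aKer_one_one_le`
(`L ≥ 12`), the elementary `log_quot_le` (`(27.6 + 46.84 ln L)/L² ≤ 0.134` for `L ≥ 39`), and
★ `pChannel_le_half : 39 ≤ L → aKer L (3/2·eps1 L) (2,0) ≤ 1/2`, ★ `dChannel_le_half : 39 ≤ L → 2·aKer L (3/2·eps1 L) (1,1) − aKer L (3/2·eps1 L) (2,0) ≤ 1/2`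
(also strict, and in both spellings of the lattice points).  The threshold `39` is what the shell-majorant constant `11.71` allows
(`L = 38` misses by `5·10⁻⁴`); `9 ≤ L ≤ 36` is kernel-certified (p3 g3 `Hole2.twoHoleGap_range36`), `L = 37, 38` are p3's per-`L` facts.
Numerically (p1 g26 independent check, brute force): `μ_p = .5776, .4791, .4354 → 1 − 2/π = .3634` (`L = 8, 12, 16, ∞`), `μ_d ≤ .341`.
Prover seat `hubbard-h0-rotor-p1` g26; helper for stmt-HubbardSuperconductivity-19089 (`--supports`, helper class).
WHAT THIS IS NOT: nothing here proves superconductivity in the Hubbard model (the rotor TARGET as worded stays FALSE, g15 verdict);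
these are two real inequalities feeding ONE hypothesis (HOLE₂) of ONE conditional reduction (rung 19089).  Tree imports only; no sorry, no axioms.
-/

set_option linter.dupNamespace false
set_option autoImplicit false

namespace Summit.HubbardSuperconductivity.HubbardSuperconductivity.Theorems.AnisotropyChord.Transfer.Fibre3

namespace ChannelLarge

variable (L : ℕ) [NeZero L]

/-! ## The λ-part at the HOLE₂ point `λ_H = (3/2)ε₁` -/

/-- `0 ≤ δ_{λ_H}(x,y) ≤ (x² + y²)(11.71 ln L + 5.9)/L²` for `L ≥ 8` (shell bound + shell majorant). [folklore] -/
theorem lamPart_lamH_bounds (hL : 8 ≤ L) (x y : ℤ) :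
    0 ≤ RateLemma.lamPart L (3 / 2 * eps1 L) (((x : ZMod L)), ((y : ZMod L))) ∧
      RateLemma.lamPart L (3 / 2 * eps1 L) (((x : ZMod L)), ((y : ZMod L)))
        ≤ ((x : ℝ) ^ 2 + (y : ℝ) ^ 2) * (11.71 * Real.log L + 5.9) / (L : ℝ) ^ 2 := by
  have hε : 0 < eps1 L := RateLemma.eps1_pos_of_two_le L (by omega)
  have h1 := RateLemma.lamPartShellBound_holds L (by omega) (3 / 2 * eps1 L) (by positivity) (by linarith)
    (((x : ZMod L)), ((y : ZMod L)))
  have h2 := RateLemma.shellMajorant_holds L hL (3 / 2 * eps1 L) (by positivity) le_rfl x y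
  exact ⟨h1.1, h1.2.trans h2⟩

/-- the split `a_L(r;λ) = a_L(r;0) + δ_λ(r)`. [folklore] -/
theorem aKer_eq_zero_add_lamPart (lam2 : ℝ) (r : Tor L) :
    aKer L lam2 r = aKer L 0 r + RateLemma.lamPart L lam2 r := by
  unfold RateLemma.lamPart; ring

/-! ## Explicit window bounds at `(2,0)` and `(1,1)` (`L ≥ 12`) -/

/-- `a_L((2,0); λ_H) ≤ 1 − 2/π + (27.6 + 46.84 ln L)/L²` for `L ≥ 12`. [folklore] -/
theorem aKer_two_zero_le (hL : 12 ≤ L) :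
    aKer L (3 / 2 * eps1 L) ((((2 : ℤ)) : ZMod L), (((0 : ℤ)) : ZMod L))
      ≤ 1 - 2 / Real.pi + (27.6 + 46.84 * Real.log L) / (L : ℝ) ^ 2 := by
  have hd := Subsample.dev_two_zero L hL
  rw [Subsample.aZ2_two_zero'] at hd
  have hl := (lamPart_lamH_bounds L (by omega) 2 0).2
  have hL0 : (0 : ℝ) < (L : ℝ) ^ 2 := by
    have : (0 : ℝ) < L := by exact_mod_cast (show 0 < L by omega)
    positivity
  rw [aKer_eq_zero_add_lamPart]
  have h1 := (abs_le.mp hd).2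
  have e : (27.6 + 46.84 * Real.log L) / (L : ℝ) ^ 2
      = 4 / (L : ℝ) ^ 2 + (((2 : ℤ) : ℝ) ^ 2 + ((0 : ℤ) : ℝ) ^ 2) * (11.71 * Real.log L + 5.9) / (L : ℝ) ^ 2 := by
    push_cast
    field_simp
    ring
  rw [e]
  linarith

/-- `1 − 2/π − 4/L² ≤ a_L((2,0); λ_H)` for `L ≥ 12` (the λ-part is nonnegative). [folklore] -/
theorem aKer_two_zero_ge (hL : 12 ≤ L) :
    1 - 2 / Real.pi - 4 / (L : ℝ) ^ 2
      ≤ aKer L (3 / 2 * eps1 L) ((((2 : ℤ)) : ZMod L), (((0 : ℤ)) : ZMod L)) := by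
  have hd := Subsample.dev_two_zero L hL
  rw [Subsample.aZ2_two_zero'] at hd
  have hl := (lamPart_lamH_bounds L (by omega) 2 0).1
  rw [aKer_eq_zero_add_lamPart]
  have h1 := (abs_le.mp hd).1
  linarith

/-- `a_L((1,1); λ_H) ≤ 1/π + (12.8 + 23.42 ln L)/L²` for `L ≥ 12`. [folklore] -/
theorem aKer_one_one_le (hL : 12 ≤ L) :
    aKer L (3 / 2 * eps1 L) ((((1 : ℤ)) : ZMod L), (((1 : ℤ)) : ZMod L))
      ≤ 1 / Real.pi + (12.8 + 23.42 * Real.log L) / (L : ℝ) ^ 2 := by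
  have hd := Subsample.dev_one_one L hL
  rw [Subsample.aZ2_one_one] at hd
  have hl := (lamPart_lamH_bounds L (by omega) 1 1).2
  have hL0 : (0 : ℝ) < (L : ℝ) ^ 2 := by
    have : (0 : ℝ) < L := by exact_mod_cast (show 0 < L by omega)
    positivity
  rw [aKer_eq_zero_add_lamPart]
  have h1 := (abs_le.mp hd).2
  have e : (12.8 + 23.42 * Real.log L) / (L : ℝ) ^ 2
      = 1 / (L : ℝ) ^ 2 + (((1 : ℤ) : ℝ) ^ 2 + ((1 : ℤ) : ℝ) ^ 2) * (11.71 * Real.log L + 5.9) / (L : ℝ) ^ 2 := by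
    push_cast
    field_simp
    ring
  rw [e]
  linarith

/-! ## The elementary large-`L` estimate -/

/-- `ln 39 ≤ 3.75` (from `exp(3.75) = exp(1/32)^120 ≥ (33/32)^120 ≥ 39`). [folklore] -/
theorem log_39_le : Real.log 39 ≤ 3.75 := by
  rw [Real.log_le_iff_le_exp (by norm_num)]
  have h1 : (1 : ℝ) / 32 + 1 ≤ Real.exp (1 / 32) := Real.add_one_le_exp _
  have h2 : Real.exp (3.75 : ℝ) = Real.exp (1 / 32) ^ 120 := by
    rw [← Real.exp_nat_mul]; norm_num
  have h3 : ((1 : ℝ) / 32 + 1) ^ 120 ≤ Real.exp (1 / 32) ^ 120 :=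
    pow_le_pow_left₀ (by norm_num) h1 120
  have h4 : (39 : ℝ) ≤ ((1 : ℝ) / 32 + 1) ^ 120 := by norm_num
  rw [h2]
  exact h4.trans h3

/-- concavity: `ln L ≤ ln 39 + L/39 − 1` for `L > 0`. [folklore] -/
theorem log_le_tangent (x : ℝ) (hx : 0 < x) : Real.log x ≤ Real.log 39 + (x / 39 - 1) := by
  have h := Real.log_le_sub_one_of_pos (show (0 : ℝ) < x / 39 by positivity)
  rw [Real.log_div hx.ne' (by norm_num)] at h
  linarith

/-- ★ for `L ≥ 39`: `(27.6 + 46.84 ln L)/L² ≤ 0.134` (value `.1309` at `L = 39`, decreasing). [folklore] -/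
theorem log_quot_le (x : ℝ) (hx : 39 ≤ x) : (27.6 + 46.84 * Real.log x) / x ^ 2 ≤ 0.134 := by
  have hx0 : 0 < x := by linarith
  have hlog : Real.log x ≤ 3.75 + (x / 39 - 1) := by
    have := log_le_tangent x hx0
    linarith [log_39_le]
  rw [div_le_iff₀ (by positivity)]
  nlinarith [mul_nonneg (sub_nonneg.mpr hx) (sub_nonneg.mpr hx), sub_nonneg.mpr hx]

/-- the same with the extra `2/L²` of the `d`-channel: `(29.6 + 46.84 ln L)/L² ≤ 0.136` for `L ≥ 39`. [folklore] -/
theorem log_quot_le' (x : ℝ) (hx : 39 ≤ x) : (29.6 + 46.84 * Real.log x) / x ^ 2 ≤ 0.136 := by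
  have hx0 : 0 < x := by linarith
  have h1 := log_quot_le x hx
  have h2 : (2 : ℝ) / x ^ 2 ≤ 2 / 39 ^ 2 := by
    apply div_le_div_of_nonneg_left (by norm_num) (by positivity)
    nlinarith
  have e : (29.6 + 46.84 * Real.log x) / x ^ 2 = (27.6 + 46.84 * Real.log x) / x ^ 2 + 2 / x ^ 2 := by
    field_simp; ring
  rw [e]
  norm_num at h2 ⊢
  linarith

/-! ## ★ The two channel inequalities for every `L ≥ 39` -/

/-- ★ `p`-CHANNEL: `μ_p = a_L((2,0); (3/2)ε₁) < 1/2` for every `L ≥ 39`. [folklore] -/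
theorem pChannel_lt_half (hL : 39 ≤ L) :
    aKer L (3 / 2 * eps1 L) ((((2 : ℤ)) : ZMod L), (((0 : ℤ)) : ZMod L)) < 1 / 2 := by
  have h1 := aKer_two_zero_le L (by omega)
  have hx : (39 : ℝ) ≤ (L : ℝ) := by exact_mod_cast hL
  have h2 := log_quot_le (L : ℝ) hx
  have hπ : 2 / (3.1416 : ℝ) < 2 / Real.pi :=
    div_lt_div_of_pos_left (by norm_num) Real.pi_pos (by linarith [Real.pi_lt_d6])
  norm_num at hπ h2 ⊢
  linarith

/-- ★ `p`-CHANNEL (non-strict form): `a_L((2,0); (3/2)ε₁) ≤ 1/2`, `L ≥ 39`. [folklore] -/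
theorem pChannel_le_half (hL : 39 ≤ L) :
    aKer L (3 / 2 * eps1 L) ((((2 : ℤ)) : ZMod L), (((0 : ℤ)) : ZMod L)) ≤ 1 / 2 :=
  (pChannel_lt_half L hL).le

/-- ★ `d`-CHANNEL: `μ_d = 2a_L((1,1); (3/2)ε₁) − a_L((2,0); (3/2)ε₁) < 1/2` for every `L ≥ 39`
(indeed `≤ 4/π − 1 + 0.136 < .41`). [folklore] -/
theorem dChannel_lt_half (hL : 39 ≤ L) :
    2 * aKer L (3 / 2 * eps1 L) ((((1 : ℤ)) : ZMod L), (((1 : ℤ)) : ZMod L))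
      - aKer L (3 / 2 * eps1 L) ((((2 : ℤ)) : ZMod L), (((0 : ℤ)) : ZMod L)) < 1 / 2 := by
  have h1 := aKer_one_one_le L (by omega)
  have h2 := aKer_two_zero_ge L (by omega)
  have hx : (39 : ℝ) ≤ (L : ℝ) := by exact_mod_cast hL
  have hL0 : (0 : ℝ) < (L : ℝ) ^ 2 := by positivity
  have h3 := log_quot_le' (L : ℝ) hx
  have e : 2 * (1 / Real.pi + (12.8 + 23.42 * Real.log L) / (L : ℝ) ^ 2) - (1 - 2 / Real.pi - 4 / (L : ℝ) ^ 2)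
      = 4 / Real.pi - 1 + (29.6 + 46.84 * Real.log L) / (L : ℝ) ^ 2 := by
    field_simp; ring
  have hπ : 4 / Real.pi < 4 / 3 := div_lt_div_of_pos_left (by norm_num) (by norm_num) Real.pi_gt_three
  norm_num at h3 ⊢
  linarith

/-- ★ `d`-CHANNEL (non-strict form), `L ≥ 39`. [folklore] -/
theorem dChannel_le_half (hL : 39 ≤ L) :
    2 * aKer L (3 / 2 * eps1 L) ((((1 : ℤ)) : ZMod L), (((1 : ℤ)) : ZMod L))
      - aKer L (3 / 2 * eps1 L) ((((2 : ℤ)) : ZMod L), (((0 : ℤ)) : ZMod L)) ≤ 1 / 2 :=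
  (dChannel_lt_half L hL).le

/-! ## The same in the numeral spelling of the lattice points, and at `λ = 2·(¾ε₁)` -/

omit [NeZero L] in
/-- `((2:ℤ) : ZMod L) = 2` etc.: the points in numeral spelling. [folklore] -/
theorem pt_two_zero : (((((2 : ℤ)) : ZMod L), (((0 : ℤ)) : ZMod L)) : Tor L) = ((2 : ZMod L), (0 : ZMod L)) := by
  push_cast; rfl

omit [NeZero L] in
/-- the point `(1,1)` in numeral spelling. [folklore] -/
theorem pt_one_one : (((((1 : ℤ)) : ZMod L), (((1 : ℤ)) : ZMod L)) : Tor L) = ((1 : ZMod L), (1 : ZMod L)) := by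
  push_cast; rfl

omit [NeZero L] in
/-- `2·(¾ε₁) = (3/2)ε₁`. [folklore] -/
theorem two_mul_threeQuarter : 2 * (3 / 4 * eps1 L) = 3 / 2 * eps1 L := by ring

/-- ★ `p`-channel, numeral spelling: `aKer L (3/2·ε₁) (2,0) ≤ 1/2`, `L ≥ 39`. [folklore] -/
theorem pChannel_le_half' (hL : 39 ≤ L) :
    aKer L (3 / 2 * eps1 L) ((2 : ZMod L), (0 : ZMod L)) ≤ 1 / 2 := by
  rw [← pt_two_zero]; exact pChannel_le_half L hL

/-- ★ `d`-channel, numeral spelling, `L ≥ 39`. [folklore] -/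
theorem dChannel_le_half' (hL : 39 ≤ L) :
    2 * aKer L (3 / 2 * eps1 L) ((1 : ZMod L), (1 : ZMod L)) - aKer L (3 / 2 * eps1 L) ((2 : ZMod L), (0 : ZMod L)) ≤ 1 / 2 := by
  rw [← pt_two_zero, ← pt_one_one]; exact dChannel_le_half L hL

/-- ★ `p`-channel at `λ = 2g`, `g = ¾ε₁` (the form of the bond Birman–Schwinger criterion), `L ≥ 39`. [folklore] -/
theorem pChannel_le_half_twoMul (hL : 39 ≤ L) :
    aKer L (2 * (3 / 4 * eps1 L)) ((2 : ZMod L), (0 : ZMod L)) ≤ 1 / 2 := by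
  rw [two_mul_threeQuarter]; exact pChannel_le_half' L hL

/-- ★ `d`-channel at `λ = 2g`, `g = ¾ε₁`, `L ≥ 39`. [folklore] -/
theorem dChannel_le_half_twoMul (hL : 39 ≤ L) :
    2 * aKer L (2 * (3 / 4 * eps1 L)) ((1 : ZMod L), (1 : ZMod L))
      - aKer L (2 * (3 / 4 * eps1 L)) ((2 : ZMod L), (0 : ZMod L)) ≤ 1 / 2 := by
  rw [two_mul_threeQuarter]; exact dChannel_le_half' L hL

end ChannelLarge

end Summit.HubbardSuperconductivity.HubbardSuperconductivity.Theorems.AnisotropyChord.Transfer.Fibre3
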